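import Summits.ResolutionOfSingularities.ResolutionOfSingularities.Theorems.FrobeniusClosingSteerBranchHasseVanishing
import Summits.ResolutionOfSingularities.ResolutionOfSingularities.Theorems.FrobeniusClosingSteerBranchLeadingTerm
import Summits.ResolutionOfSingularities.ResolutionOfSingularities.Theorems.FrobeniusClosingSteerBranchNormalForm
import Summits.ResolutionOfSingularities.ResolutionOfSingularities.Theorems.FrobeniusClosingSteerBinaryTaylorCoeff
import Summits.ResolutionOfSingularities.ResolutionOfSingularities.Theorems.FrobeniusClosingSteerTranslationInvariantForm
import HarnessLib

/-!
# K-β7-hat W2 (`BranchObstruction`), block δ-core — the branch obstruction in hat coordinates, ASSEMBLED (W4.1, OURS)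

The algebraic heart of W2 (res-L0-w41-idea-1 `K7HatWords-idea-1-g12.lean` cbdb8a4f311bfcb9 l.223; memo
`CANONICAL-CLEANING-g10.md` §12.3 (3)+(4), §12.4; RULING 237(b)) as ONE theorem in the Cohen coordinates
`κT⟦X₀, X₁, X₂, X₃⟧` of the hat ring, free of run vocabulary:

**`false_of_parametrisedBranch`.** Data: a cone `Ψ ∈ κR[Z, W]` homogeneous of ODD degree `d ≥ 2`, ANISOTROPIC
over the residue field `κR` (characteristic 2), the residue-field map `ψ : κR → κT`; the radicand in NORMAL FORM
`F = Q² + Σ_{ν} C_ν · L₂^{ν₀} L₃^{ν₁} + M` (`L₂ ≡ X₂, L₃ ≡ X₃ mod (X₀, X₁)`, `M ∈ 𝔪^{d+1}`, `C_ν(0) = ψ(Ψ_ν)`); the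
formal-centre datum `F + Q′² ∈ (X₀, X₂, X₃)^d`; a prime `𝒫` killed by a BRANCH PARAMETRISATION
`γ : κT⟦X⟧ →+* L⟦τ⟧` (`γ X₀ = 0`, `τ ∣ γ X₁`, `γ X₂ = τ^m ζ₁`, `γ X₃ = τ^m ω₁`, `m ≥ 1`, tangent vector
`(ζ₁(0), ω₁(0)) ≠ 0`); and the square-descent datum `U² F + R² ∈ 𝒫^d` with `γ U ≠ 0`. Conclusion: `False`.

Chain: block α (`…BranchHasseVanishing`: `γ (Δ_α ∂_i F) = 0`, `|α| ≤ d − 2`) ⟶ block β (`…BranchLeadingTerm`: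
the `τ^{(e−k)m}`-coefficient `S_α` of `γ (Δ_α ∂_i F)` vanishes) ⟶ block γ (`…BranchNormalForm`: the pure
coefficients of `∂₂F, ∂₃F` are those of `∂_Z Ψ̄, ∂_W Ψ̄`, read through `φ ∘ ψ`, `φ c := (γ (C c))(0)`) ⟶ δ-prep
(`…BinaryTaylorCoeff`: `S_α` IS the Taylor coefficient of `∂Ψ̄ ⊗ L` at `t`) ⟶ `…TranslationTaylor`
(translation invariance of both partials) ⟶ `…TranslationInvariantForm.false_of_pderiv_translation_invariant`
(impossible for an odd anisotropic form in characteristic 2, `…OddAnisotropicNoAlmostPower`).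

What remains for `branchObstruction_holds : K7Hat.BranchObstruction` (block δ-final): produce these data from the
word's hypotheses — the Cohen frame of `T` on `(ι x, ι y, z′, w′)` (`CanonicalCleaning.exists_ringEquiv_mvPowerSeries_four`,
res-D-pv-035's `hatCoordinates_holds`), the transport of `P₁ / Q₀ /` the two data, and the parametrisation of a
second branch `𝔓 ≠ P₁` (res-D-lit-1's `exists_branchParametrization_of_complete`). Everything here is OURS,
AI-written and AI-checked only; nothing is a statement of [Hironaka2017]. -/

set_option linter.dupNamespace false
set_option autoImplicit false

namespace Summit.ResolutionOfSingularities.ResolutionOfSingularities.Theorems.SwitchingDichotomy.BranchCore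

open MvPowerSeries
open IsLocalRing (maximalIdeal)
open Literature.RingTheory.MvPowerSeries (hasseDeriv mchoose pd)
open Summit.ResolutionOfSingularities.ResolutionOfSingularities.Theorems.SwitchingDichotomy.BranchHasse
  (map_hasseDeriv_pd_eq_zero pd_sq_mul_add_sq pd_mem_pow_sub)
open Summit.ResolutionOfSingularities.ResolutionOfSingularities.Theorems.SwitchingDichotomy.BranchLeading
  (main_leading_term mem_pure_iff)
open Summit.ResolutionOfSingularities.ResolutionOfSingularities.Theorems.SwitchingDichotomy.BranchNormalForm
  (le_vdeg_of_mem_span_X_pow coeff_pure_eq coeff_pure_pd_two coeff_pure_pd_three)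

variable {κT L : Type*} [Field κT] [Field L]

/-- `τ^{M+1} ∣ C(s)·τ^M` forces `s = 0`. OURS. -/
theorem eq_zero_of_X_pow_succ_dvd (s : L) (M : ℕ)
    (h : (PowerSeries.X : PowerSeries L) ^ (M + 1) ∣ PowerSeries.C s * PowerSeries.X ^ M) : s = 0 := by
  obtain ⟨g, hg⟩ := h
  have hc := congrArg (PowerSeries.coeff M) hg
  rw [PowerSeries.coeff_C_mul_X_pow, if_pos rfl, PowerSeries.coeff_X_pow_mul', if_neg (by omega)] at hc
  exact hc

/-- The support condition for `∂_i F` out of `F + Q'² ∈ (X₀, X₂, X₃)^d`: every `X₀`-free monomial of `∂_i F`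
has `(X₂, X₃)`-degree `≥ d − 1`. OURS. -/
theorem support_pd_of_mem_pow [CharP κT 2] {d : ℕ} (F Q' : MvPowerSeries (Fin 4) κT)
    (hP1 : F + Q' ^ 2 ∈ Ideal.span {(X 0 : MvPowerSeries (Fin 4) κT), X 2, X 3} ^ d) (i : Fin 4) :
    ∀ β : Fin 4 →₀ ℕ, coeff β (pd i F) ≠ 0 → β 0 = 0 → d - 1 ≤ β 2 + β 3 := by
  classical
  intro β hβ hβ0
  have hE : (1 : MvPowerSeries (Fin 4) κT) ^ 2 * F + Q' ^ 2 ∈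
      Ideal.span {(X 0 : MvPowerSeries (Fin 4) κT), X 2, X 3} ^ d := by rwa [one_pow, one_mul]
  have hpd : pd i F ∈ Ideal.span {(X 0 : MvPowerSeries (Fin 4) κT), X 2, X 3} ^ (d - 1) := by
    have h := pd_mem_pow_sub _ d i hE
    rwa [pd_sq_mul_add_sq, one_pow, one_mul] at h
  have hspan : Ideal.span {(X 0 : MvPowerSeries (Fin 4) κT), X 2, X 3} =
      Ideal.span ((fun i => (X i : MvPowerSeries (Fin 4) κT)) '' (({0, 2, 3} : Finset (Fin 4)) : Set (Fin 4))) := by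
    congr 1
    ext g
    simp only [Set.mem_insert_iff, Set.mem_singleton_iff, Finset.coe_insert, Finset.coe_singleton, Set.mem_image]
    constructor
    · rintro (rfl | rfl | rfl)
      exacts [⟨0, Or.inl rfl, rfl⟩, ⟨2, Or.inr (Or.inl rfl), rfl⟩, ⟨3, Or.inr (Or.inr rfl), rfl⟩]
    · rintro ⟨j, (rfl | rfl | rfl), rfl⟩
      exacts [Or.inl rfl, Or.inr (Or.inl rfl), Or.inr (Or.inr rfl)]
  rw [hspan] at hpd
  have h := le_vdeg_of_mem_span_X_pow {0, 2, 3} (d - 1) hpd β hβ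
  simp [Finset.sum_insert, hβ0] at h
  omega

/-- The multi-index binomial of two PURE exponents is the product of two ordinary binomials. OURS. -/
theorem mchoose_pure (a b i j : ℕ) :
    mchoose (Finsupp.single (2 : Fin 4) a + Finsupp.single 3 b) (Finsupp.single 2 i + Finsupp.single 3 j) =
      a.choose i * b.choose j := by
  rw [mchoose, Fin.prod_univ_four]
  simp

/-- `a ↦ (0, 0, a, e − a)` is injective on `range (e + 1)`. OURS. -/
theorem pure4_injOn (e : ℕ) :
    Set.InjOn (fun a => Finsupp.single (2 : Fin 4) a + Finsupp.single 3 (e - a)) (Finset.range (e + 1) : Set ℕ) := by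
  intro a _ a' _ h
  have := DFunLike.congr_fun h 2
  simpa [Finsupp.single_apply] using this

/-- `a ↦ (a, e − a)` is injective on `range (e + 1)`. OURS. -/
theorem pure2_injOn (e : ℕ) :
    Set.InjOn (fun a => Finsupp.single (0 : Fin 2) a + Finsupp.single 1 (e - a)) (Finset.range (e + 1) : Set ℕ) := by
  intro a _ a' _ h
  have := DFunLike.congr_fun h 0
  simpa [Finsupp.single_apply] using this

section Main

variable {κR : Type*} [Field κR] [CharP κT 2]
  (ψ : κR →+* κT) (γ : MvPowerSeries (Fin 4) κT →+* PowerSeries L)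
  {d : ℕ} (hd : Odd d) (h2d : 2 ≤ d)
  (Ψ : MvPolynomial (Fin 2) κR)
  (F Q M A B A' B' : MvPowerSeries (Fin 4) κT) (S : Finset (Fin 2 →₀ ℕ))
  (Cν : (Fin 2 →₀ ℕ) → MvPowerSeries (Fin 4) κT)
  (hSupp : Ψ.support ⊆ S) (hS : ∀ ν ∈ S, ν 0 + ν 1 = d)
  (hC : ∀ ν ∈ S, constantCoeff (Cν ν) = ψ (MvPolynomial.coeff ν Ψ))
  (hM : M ∈ maximalIdeal (MvPowerSeries (Fin 4) κT) ^ (d + 1))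
  (hF : F = Q ^ 2 + (∑ ν ∈ S, Cν ν * ((X 2 + X 0 * A + X 1 * B) ^ (ν 0) * (X 3 + X 0 * A' + X 1 * B') ^ (ν 1))) + M)

include hd h2d hS hC hM hF hSupp in
/-- **Pure coefficients of `∂₂F` are the cone's `∂_Z Ψ̄`-coefficients** (block γ instantiated), read in `L`.
OURS. -/
theorem map_coeff_pure_pd_two {a b : ℕ} (hab : a + b = d - 1) :
    (PowerSeries.constantCoeff.comp (γ.comp (MvPowerSeries.C))) (coeff (Finsupp.single 2 a + Finsupp.single 3 b) (pd 2 F)) =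
      ((PowerSeries.constantCoeff.comp (γ.comp (MvPowerSeries.C))).comp ψ)
        (MvPolynomial.coeff (Finsupp.single 0 a + Finsupp.single 1 b) (MvPolynomial.pderiv 0 Ψ)) := by
  classical
  have hab' : a + 1 + b = d := by omega
  set φ : κT →+* L := PowerSeries.constantCoeff.comp (γ.comp (MvPowerSeries.C)) with hφ
  rw [coeff_pure_pd_two, coeff_pure_eq hd F Q M A B A' B' S Cν hS hM hF hab',
    Literature.RingTheory.MvPowerSeries.coeff_pderiv_eq]
  have hx0 : (Finsupp.single (0 : Fin 2) a + Finsupp.single 1 b : Fin 2 →₀ ℕ) 0 = a := by simp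
  have hx1 : Finsupp.single (0 : Fin 2) a + Finsupp.single 1 b + Finsupp.single 0 1 =
      Finsupp.single 0 (a + 1) + Finsupp.single 1 b := by
    ext s; fin_cases s <;> simp [add_comm, add_assoc]
  rw [hx0, hx1]
  set ν₀ : Fin 2 →₀ ℕ := Finsupp.single 0 (a + 1) + Finsupp.single 1 b with hν₀
  have key : φ (∑ ν ∈ S, if ν = ν₀ then constantCoeff (Cν ν) else 0) = (φ.comp ψ) (MvPolynomial.coeff ν₀ Ψ) := by
    by_cases hmem : ν₀ ∈ S
    · rw [Finset.sum_eq_single_of_mem ν₀ hmem (fun ν _ hν => if_neg hν), if_pos rfl, hC ν₀ hmem]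
      rfl
    · have hz : ∑ ν ∈ S, (if ν = ν₀ then constantCoeff (Cν ν) else 0) = 0 := by
        refine Finset.sum_eq_zero fun ν hν => ?_
        rw [if_neg]
        rintro rfl
        exact hmem hν
      rw [hz, map_zero, MvPolynomial.notMem_support_iff.mp (fun h => hmem (hSupp h)), map_zero]
  rw [map_mul, map_natCast, map_mul, map_natCast, key]

include hd h2d hS hC hM hF hSupp in
/-- The same for `∂₃F` and `∂_W Ψ̄`. OURS. -/
theorem map_coeff_pure_pd_three {a b : ℕ} (hab : a + b = d - 1) :
    (PowerSeries.constantCoeff.comp (γ.comp (MvPowerSeries.C))) (coeff (Finsupp.single 2 a + Finsupp.single 3 b) (pd 3 F)) =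
      ((PowerSeries.constantCoeff.comp (γ.comp (MvPowerSeries.C))).comp ψ)
        (MvPolynomial.coeff (Finsupp.single 0 a + Finsupp.single 1 b) (MvPolynomial.pderiv 1 Ψ)) := by
  classical
  have hab' : a + (b + 1) = d := by omega
  set φ : κT →+* L := PowerSeries.constantCoeff.comp (γ.comp (MvPowerSeries.C)) with hφ
  rw [coeff_pure_pd_three, coeff_pure_eq hd F Q M A B A' B' S Cν hS hM hF hab',
    Literature.RingTheory.MvPowerSeries.coeff_pderiv_eq]
  have hx0 : (Finsupp.single (0 : Fin 2) a + Finsupp.single 1 b : Fin 2 →₀ ℕ) 1 = b := by simp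
  have hx1 : Finsupp.single (0 : Fin 2) a + Finsupp.single 1 b + Finsupp.single 1 1 =
      Finsupp.single 0 a + Finsupp.single 1 (b + 1) := by
    ext s; fin_cases s <;> simp [add_assoc]
  rw [hx0, hx1]
  set ν₀ : Fin 2 →₀ ℕ := Finsupp.single 0 a + Finsupp.single 1 (b + 1) with hν₀
  have key : φ (∑ ν ∈ S, if ν = ν₀ then constantCoeff (Cν ν) else 0) = (φ.comp ψ) (MvPolynomial.coeff ν₀ Ψ) := by
    by_cases hmem : ν₀ ∈ S
    · rw [Finset.sum_eq_single_of_mem ν₀ hmem (fun ν _ hν => if_neg hν), if_pos rfl, hC ν₀ hmem]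
      rfl
    · have hz : ∑ ν ∈ S, (if ν = ν₀ then constantCoeff (Cν ν) else 0) = 0 := by
        refine Finset.sum_eq_zero fun ν hν => ?_
        rw [if_neg]
        rintro rfl
        exact hmem hν
      rw [hz, map_zero, MvPolynomial.notMem_support_iff.mp (fun h => hmem (hSupp h)), map_zero]
  rw [map_mul, map_natCast, map_mul, map_natCast, key]

include hd h2d hS hC hM hF hSupp in
/-- **THE BRANCH OBSTRUCTION, parametrised form** (memo §12.3 (3)+(4) + §12.4, all blocks assembled). Given the
hat-coordinate data of W2 — the radicand `F` in normal form with an ODD-degree cone `Ψ` anisotropic over `κR`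
(char 2), the square-descent datum `U²F + R² ∈ 𝒫^d` along a prime `𝒫 ⊆ ker γ` with `γ U ≠ 0`, the formal-centre
datum `F + Q'² ∈ (X₀, X₂, X₃)^d`, and a branch parametrisation `γ : κT⟦X⟧ → L⟦τ⟧` with `γ X₀ = 0`, `τ ∣ γ X₁`,
`γ X₂ = τ^m ζ₁`, `γ X₃ = τ^m ω₁`, tangent vector `(ζ₁(0), ω₁(0)) ≠ 0` — a contradiction. OURS. -/
theorem false_of_parametrisedBranch [CharP κR 2]
    (P : Ideal (MvPowerSeries (Fin 4) κT)) (hPγ : ∀ f ∈ P, γ f = 0)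
    (h0 : γ (X 0) = 0) (hy : PowerSeries.X ∣ γ (X 1)) (ζ₁ ω₁ : PowerSeries L) {m : ℕ} (hm : 1 ≤ m)
    (h2 : γ (X 2) = PowerSeries.X ^ m * ζ₁) (h3 : γ (X 3) = PowerSeries.X ^ m * ω₁)
    (ht : PowerSeries.constantCoeff ζ₁ ≠ 0 ∨ PowerSeries.constantCoeff ω₁ ≠ 0)
    (hΨ : Ψ.IsHomogeneous d)
    (han : ∀ a b : κR, (a ≠ 0 ∨ b ≠ 0) → MvPolynomial.eval ![a, b] Ψ ≠ 0)
    (Q' U Rr : MvPowerSeries (Fin 4) κT)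
    (hP1 : F + Q' ^ 2 ∈ Ideal.span {(X 0 : MvPowerSeries (Fin 4) κT), X 2, X 3} ^ d)
    (hU : γ U ≠ 0) (hE : U ^ 2 * F + Rr ^ 2 ∈ P ^ d) : False := by
  classical
  set φ : κT →+* L := PowerSeries.constantCoeff.comp (γ.comp (MvPowerSeries.C)) with hφ
  letI : Algebra κR L := (φ.comp ψ).toAlgebra
  have halg : algebraMap κR L = φ.comp ψ := rfl
  set e := d - 1 with he
  set t₂ := PowerSeries.constantCoeff ζ₁ with ht₂
  set t₃ := PowerSeries.constantCoeff ω₁ with ht₃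
  -- the two binary forms `∂_Z Ψ̄`, `∂_W Ψ̄` over `L`
  have hhom : ∀ j : Fin 2, (MvPolynomial.pderiv j (MvPolynomial.map (algebraMap κR L) Ψ)).IsHomogeneous e :=
    fun j => (hΨ.map _).pderiv
  -- S_α = 0 for the pure derivatives of `∂_i F`, `i = 2, 3`
  have hS0 : ∀ (i : Fin 4), (i = 2 ∨ i = 3) → ∀ a' b' : ℕ, a' + b' < e →
      ∑ β ∈ (Finset.range (e + 1)).image (fun a => Finsupp.single (2 : Fin 4) a + Finsupp.single 3 (e - a)),
        (mchoose β (Finsupp.single 2 a' + Finsupp.single 3 b') : L) *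
          PowerSeries.constantCoeff (γ (MvPowerSeries.C (coeff β (pd i F)))) *
          t₂ ^ (β 2 - a') * t₃ ^ (β 3 - b') = 0 := by
    intro i hi a' b' hab
    set α : Fin 4 →₀ ℕ := Finsupp.single 2 a' + Finsupp.single 3 b' with hα
    have hα0 : α 0 = 0 := by simp [hα]
    have hα1 : α 1 = 0 := by simp [hα]
    have hα2 : α 2 = a' := by simp [hα]
    have hα3 : α 3 = b' := by simp [hα]
    have hG := support_pd_of_mem_pow F Q' hP1 i
    have hvan : γ (hasseDeriv α (pd i F)) = 0 := by
      refine map_hasseDeriv_pd_eq_zero γ P hPγ h2d U F Rr hU hE i α ?_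
      rw [Finsupp.degree_eq_sum, Fin.sum_univ_four, hα0, hα1, hα2, hα3]; omega
    have hlead := main_leading_term γ h0 hy ζ₁ ω₁ hm h2 h3 (pd i F) e
      (fun β hβ hβ0 => by have := hG β hβ hβ0; omega) α hα0 hα1 (by rw [hα2, hα3]; omega)
    rw [hvan, zero_sub, dvd_neg, hα2, hα3] at hlead
    have := eq_zero_of_X_pow_succ_dvd _ _ hlead
    simpa only [hα2, hα3] using this
  -- the Taylor coefficients of `∂_j Ψ̄ ⊗ L` at `t` vanish below degree `e`
  have htaylor : ∀ (j : Fin 2), ∀ α' : Fin 2 →₀ ℕ, α' 0 + α' 1 < e →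
      MvPolynomial.coeff α' (MvPolynomial.bind₁
        (![MvPolynomial.X 0 + MvPolynomial.C t₂, MvPolynomial.X 1 + MvPolynomial.C t₃] :
          Fin 2 → MvPolynomial (Fin 2) L)
        (MvPolynomial.pderiv j (MvPolynomial.map (algebraMap κR L) Ψ))) = 0 := by
    intro j α' hα'
    set Φ := MvPolynomial.pderiv j (MvPolynomial.map (algebraMap κR L) Ψ) with hΦ
    -- support of `Φ` inside the pure binary exponents of degree `e`
    have hsupp : Φ.support ⊆ (Finset.range (e + 1)).image
        (fun a => Finsupp.single (0 : Fin 2) a + Finsupp.single 1 (e - a)) := by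
      intro β hβ
      have hdeg : β 0 + β 1 = e := by
        have h := (hhom j) (MvPolynomial.mem_support_iff.mp hβ)
        simpa [Finsupp.weight_apply, Finsupp.sum_fintype, Fin.sum_univ_two] using h
      refine Finset.mem_image.mpr ⟨β 0, Finset.mem_range.mpr (by omega), ?_⟩
      ext s; fin_cases s
      · simp
      · simp; omega
    rw [BinaryTaylor.coeff_transl_eq_sum_of_subset Φ t₂ t₃ α' hsupp,
      Finset.sum_image (pure2_injOn e)]
    -- compare with `S_α = 0` for `i = 2` (`j = 0`) resp. `i = 3` (`j = 1`)
    have hSα := hS0 (if j = 0 then 2 else 3) (by fin_cases j <;> simp) (α' 0) (α' 1) hα'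
    rw [Finset.sum_image (pure4_injOn e)] at hSα
    rw [← hSα]
    refine Finset.sum_congr rfl fun a ha => ?_
    rw [Finset.mem_range] at ha
    have hcoef : MvPolynomial.coeff (Finsupp.single (0 : Fin 2) a + Finsupp.single 1 (e - a)) Φ =
        φ (coeff (Finsupp.single (2 : Fin 4) a + Finsupp.single 3 (e - a)) (pd (if j = 0 then 2 else 3) F)) := by
      rw [hΦ, MvPolynomial.pderiv_map, MvPolynomial.coeff_map, halg]
      fin_cases j
      · simp only [Fin.zero_eta, Fin.isValue, if_true]
        rw [map_coeff_pure_pd_two ψ γ hd h2d Ψ F Q M A B A' B' S Cν hSupp hS hC hM hF (by omega)]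
      · simp only [Fin.mk_one, Fin.isValue, one_ne_zero, if_false]
        rw [map_coeff_pure_pd_three ψ γ hd h2d Ψ F Q M A B A' B' S Cν hSupp hS hC hM hF (by omega)]
    have hφx : ∀ x, PowerSeries.constantCoeff (γ (MvPowerSeries.C x)) = φ x := fun x => rfl
    have hb0 : (Finsupp.single (0 : Fin 2) a + Finsupp.single 1 (e - a) : Fin 2 →₀ ℕ) 0 = a := by simp
    have hb1 : (Finsupp.single (0 : Fin 2) a + Finsupp.single 1 (e - a) : Fin 2 →₀ ℕ) 1 = e - a := by simp
    have hβ2 : (Finsupp.single (2 : Fin 4) a + Finsupp.single 3 (e - a) : Fin 4 →₀ ℕ) 2 = a := by simp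
    have hβ3 : (Finsupp.single (2 : Fin 4) a + Finsupp.single 3 (e - a) : Fin 4 →₀ ℕ) 3 = e - a := by simp
    rw [hcoef, mchoose_pure, hb0, hb1, hβ2, hβ3, hφx]
    push_cast
    ring
  -- translation invariance of both partials, then the contradiction
  have hinv : ∀ j : Fin 2, MvPolynomial.bind₁
      (![MvPolynomial.X 0 + MvPolynomial.C t₂, MvPolynomial.X 1 + MvPolynomial.C t₃] :
        Fin 2 → MvPolynomial (Fin 2) L)
      (MvPolynomial.pderiv j (MvPolynomial.map (algebraMap κR L) Ψ)) =
      MvPolynomial.pderiv j (MvPolynomial.map (algebraMap κR L) Ψ) :=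
    fun j => TranslationTaylor.transl_eq_self_of_coeff_eq_zero (hhom j) t₂ t₃ (htaylor j)
  exact TranslationInvariant.false_of_pderiv_translation_invariant hd hΨ han t₂ t₃ ht (hinv 0) (hinv 1)

end Main

end Summit.ResolutionOfSingularities.ResolutionOfSingularities.Theorems.SwitchingDichotomy.BranchCore
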